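import Summits.QuantumFields.YangMills.Theorems.DiagonalMirrorRPRCubeSurgeryDefs
import Summits.QuantumFields.YangMills.Theorems.DiagonalMirrorRPRWilsonDiagonalModelMirrorFamily
import Summits.QuantumFields.YangMills.Theorems.DiagonalMirrorRPRWilsonDiagonalModelSlabSupport
import Summits.QuantumFields.YangMills.Theorems.DiagonalMirrorRPROddTorusSwapPairingDefs
import Summits.QuantumFields.YangMills.Theorems.DiagonalMirrorRPRTwistedTraceSeries
import Summits.QuantumFields.YangMills.Theorems.MirrorModularBoostsHypercubicLimitSubschemeDefs
import Literature.MathematicalPhysics.QuantumFieldTheory.StrongCouplingActivities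

/-!
# Crux `WeakCouplingHypercubicLimitRP` (stmt-QuantumFields-27398), line `Sketch`, stub D1′ `stub_oddTorusSwapPairingLiminf`, door C
# (`cube-surgery-decoupling`, card #114): S1b — the free-cube Gram pairing of a reflected family is EVENTUALLY `≥ 0` — and door C's
# composition `D1′ ⟸ CubeHalfRP ∧ AdmissibleCubeDecoupling` (the cube swap-RP S1a enters as a hypothesis; discharged in
# `…PencilRigidityWeakCouplingHypercubicLimitRPOfCubeDecoupling`)

Helper file (`--supports stmt-QuantumFields-27398 --as helper`) of the crux lead `lead-27398-D1` (gen 2; PICKED.md of record); it closes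
nothing by itself.

WHAT.
* §1 the free-cube measure `cubeMeasure ρ β S R` (p828144) is a probability measure (`isProbabilityMeasure_cubeMeasure`, pattern of
  `isProbabilityMeasure_wilsonMeasure`), and the free-cube Gram pairing of a reflected family is ONE free-cube expectation
  `cubeGramPairing r sch R F k = ∫ Y_k(F)((Θ U)~) · Y_k(F)(Ũ) dμ_{Q_{R_k}}(U)` (`cubeGramPairing_eq_integral_famObs_swap`; the proof of hand-2's
  `gramPairing_eq_integral_famObs_swap` (`…WilsonDiagonalModelMirrorFamily`) verbatim with the cube measure).
* §2 SUPPORT: for every reflected family `F` and radii `R_k ≤ L_k` with `a_k R_k → ∞`, EVENTUALLY in `k` the family observable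
  `Y_k(F) ∘ torusLift` depends only on the links of the closed positive half-cube `PosHalfEdge (side k) (R k)` (`eventually_dependsOn_famObs`:
  the supports are compact in `{x₁ < x₀}`, so charged lattice points have `x₀ − x₁ ≥ δ/a_k ≥ 2ϱ+1` and `|x_μ| ≤ D/a_k ≤ R_k − ϱ − 1`, `ϱ` a
  radius of the curvature's edge support; `rep_proj_of_abs_le`: inside the box the centred representative of a lifted point is the point).
* §3 **S1b** `eventually_cubeGramPairing_nonneg`: `CubeHalfRP G → (∀ᶠ k, 0 ≤ β_k) → (∀ k, R_k ≤ L_k) → a_k R_k → ∞ →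
  ∀ F, ∀ᶠ k, 0 ≤ cubeGramPairing r sch R F k`.
* §4 door C's composition `pairingLiminf_of_cubeHalfRP`: `CubeHalfRP G → (∀ᶠ k, 0 ≤ β_k) → (∀ k, R_k ≤ L_k) → a_k R_k → ∞ →
  CubeDecoupling r sch R → OddTorusSwapPairingLiminf r sch` (the socket BY NAME, p827497; `liminf_nonneg_of_eventually_ge`), its scheme-level
  packaging `oddTorusSwapPairingLiminf_of_cubeHalfRP_of_admissible` (weak coupling ⇒ `β_k ≥ 0` eventually) and the form ALONG `φ`
  `oddTorusSwapPairingLiminf_subseq_of_cubeHalfRP` (`(subseq sch φ hφ).HasWeakCouplingLimit` from the scheme's, `hasWeakCouplingLimit_subseq`).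

HONEST FRAMING: S1b and the composition are bookkeeping; the cube swap-RP `CubeHalfRP G` is a HYPOTHESIS here (proved in
`…DiagonalMirrorRPRCubeHalfRP`, lead-27398-D1 g2) and the letter `CubeDecoupling` / `AdmissibleCubeDecoupling` is NOT proved anywhere for
non-abelian `G` at weak coupling.  D1′, ⟨27398⟩ and its heart S6i are OPEN; nothing here bears on the summit; the Yang–Mills mass gap is NOT
proved here or anywhere in the tree.  No definition, no instance, no notation, `autoImplicit false`.

References: Fröhlich–Israel–Lieb–Simon, Comm. Math. Phys. 62 (1978) Thm 2.1; Osterwalder–Seiler, Ann. Phys. 110 (1978) §2–3; Seiler, LNP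
159 (1982) Ch. 2.
-/

set_option autoImplicit false

noncomputable section

open scoped SchwartzMap
open MeasureTheory Filter Topology
open Literature.MathematicalPhysics.QuantumLattice Literature.MathematicalPhysics.AQFT
  Literature.MathematicalPhysics.QuantumFieldTheory
open Literature.Probability.LatticeModels (box)
open Summit.QuantumFields.YangMills.Cruxes.HypercubicLimit.CouplingResponse
open Summit.QuantumFields.YangMills.Cruxes.DiagonalMirrorRPR.ParityBridgeColdTraces (E4)
open Summit.QuantumFields.YangMills.Cruxes.DiagonalMirrorRPR.ParityBridgeColdTraces.RpClosure (exists_abs_smearedLatticeField_le exists_radius)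
open Summit.QuantumFields.YangMills.Cruxes.DiagonalMirrorRPR.SignTwistedDiagonalTrace
open Summit.QuantumFields.YangMills.Cruxes.DiagonalMirrorRPR.SignTwistedDiagonalTrace.WilsonDiagonal

namespace Summit.QuantumFields.YangMills.Cruxes.DiagonalMirrorRPR.CubeSurgery

/-! ## §1 The free-cube measure is a probability measure; the free-cube Gram pairing as one expectation -/

section Measure

variable {G : Type} [Group G] [TopologicalSpace G] [IsTopologicalGroup G] [CompactSpace G] [MeasurableSpace G] [BorelSpace G]
  {N : ℕ} (ρ : G →* Matrix (Fin N) (Fin N) ℂ)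

omit [IsTopologicalGroup G] [MeasurableSpace G] [BorelSpace G] in
/-- The free-cube action is bounded. -/
theorem exists_abs_cubeAction_le (hρ : Continuous ρ) (S R : ℕ) [NeZero S] :
    ∃ B : ℝ, ∀ U : GaugeConfig 4 S G, |cubeAction ρ S R U| ≤ B := by
  obtain ⟨M, -, hM⟩ := exists_bound_trace_re_nonneg ρ hρ
  refine ⟨∑ _p : Plaquette 4 S, ((N : ℝ) + M), fun U => ?_⟩
  unfold cubeAction
  refine (Finset.abs_sum_le_sum_abs _ _).trans (Finset.sum_le_sum fun p _ => ?_)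
  split_ifs
  · refine (abs_sub _ _).trans ?_
    rw [Nat.abs_cast]
    exact add_le_add le_rfl (hM _)
  · rw [abs_zero]
    exact add_nonneg (Nat.cast_nonneg _) ((abs_nonneg _).trans (hM 1))

/-- **The free-cube measure is a probability measure** (continuous `ρ`). -/
theorem isProbabilityMeasure_cubeMeasure (hρ : Continuous ρ) (β : ℝ) (S R : ℕ) [NeZero S] :
    IsProbabilityMeasure (cubeMeasure (G := G) ρ β S R) := by
  obtain ⟨B, hB⟩ := exists_abs_cubeAction_le (G := G) ρ hρ S R
  set π : Measure (GaugeConfig 4 S G) := Measure.pi fun _ : Edge 4 S => haarProbability G with hπ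
  have hZ : cubeWeight (G := G) ρ β S R Set.univ = ∫⁻ U, ENNReal.ofReal (Real.exp (-β * cubeAction ρ S R U)) ∂π := by
    simp only [cubeWeight, withDensity_apply _ MeasurableSet.univ, Measure.restrict_univ, hπ]
  have hbound : ∀ U : GaugeConfig 4 S G, |β * cubeAction ρ S R U| ≤ |β| * B := fun U => by
    rw [abs_mul]; exact mul_le_mul_of_nonneg_left (hB U) (abs_nonneg _)
  have hlow : ENNReal.ofReal (Real.exp (-(|β| * B))) ≤ cubeWeight (G := G) ρ β S R Set.univ := by
    rw [hZ]
    calc ENNReal.ofReal (Real.exp (-(|β| * B)))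
        = ∫⁻ _U, ENNReal.ofReal (Real.exp (-(|β| * B))) ∂π := by rw [lintegral_const, measure_univ, mul_one]
      _ ≤ _ := lintegral_mono fun U => ENNReal.ofReal_le_ofReal (Real.exp_le_exp.2 (by
          have := (abs_le.1 (hbound U)).2
          linarith))
  have hup : cubeWeight (G := G) ρ β S R Set.univ ≤ ENNReal.ofReal (Real.exp (|β| * B)) := by
    rw [hZ]
    calc _ ≤ ∫⁻ _U, ENNReal.ofReal (Real.exp (|β| * B)) ∂π :=
          lintegral_mono fun U => ENNReal.ofReal_le_ofReal (Real.exp_le_exp.2 (by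
            have := (abs_le.1 (hbound U)).1
            linarith))
      _ = _ := by rw [lintegral_const, measure_univ, mul_one]
  have h0 : cubeWeight (G := G) ρ β S R Set.univ ≠ 0 := (lt_of_lt_of_le (ENNReal.ofReal_pos.2 (Real.exp_pos _)) hlow).ne'
  have htop : cubeWeight (G := G) ρ β S R Set.univ ≠ ⊤ := ne_top_of_le_ne_top ENNReal.ofReal_ne_top hup
  constructor
  simp only [cubeMeasure, Measure.smul_apply, smul_eq_mul]
  exact ENNReal.inv_mul_cancel h0 htop

variable (r : LatticeRep G) (sch : SpeciesScheme (YMSpecies G)) (R : ℕ → ℕ)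

/-- **The free-cube Gram pairing as ONE free-cube expectation**: `cubeGramPairing r sch R F k = ∫ Y_k(F)((Θ U)~) · Y_k(F)(Ũ) dμ_{Q_{R_k}}(U)`
(hand-2's `gramPairing_eq_integral_famObs_swap` with Wilson's torus measure replaced by the free-cube measure). -/
theorem cubeGramPairing_eq_integral_famObs_swap (F : ReflectedFamily) (k : ℕ) :
    cubeGramPairing r sch R F k =
      ∫ U, famObs r sch F k (torusLift (sch.side k) (configPerm (Equiv.swap (0 : Fin 4) 1) U)) *
          famObs r sch F k (torusLift (sch.side k) U) ∂(cubeMeasure r.ρ (sch.β k) (sch.side k) (R k)) := by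
  haveI := isProbabilityMeasure_cubeMeasure (G := G) r.ρ r.continuous (sch.β k) (sch.side k) (R k)
  set μ : Measure (GaugeConfig 4 (sch.side k) G) := cubeMeasure r.ρ (sch.β k) (sch.side k) (R k) with hμ
  set A : Fin F.m → GaugeConfig 4 (sch.side k) G → ℝ := fun i U =>
    ∏ j, smearedLatticeField r.curvature.F (box 4 (sch.L k)) (sch.a k) (sch.c r.curvature k) (sch.m r.curvature k) (F.σf i j)
      (torusLift (sch.side k) U) with hA
  set B : Fin F.m → GaugeConfig 4 (sch.side k) G → ℝ := fun i U =>
    ∏ j, smearedLatticeField r.curvature.F (box 4 (sch.L k)) (sch.a k) (sch.c r.curvature k) (sch.m r.curvature k) (F.f i j)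
      (torusLift (sch.side k) U) with hB
  have hAm : ∀ i, Measurable (A i) := fun i =>
    Finset.measurable_prod _ fun j _ => measurable_smearedLatticeField_torusLift' r.curvature _ _ _ _ (F.σf i j) _
  have hBm : ∀ i, Measurable (B i) := fun i =>
    Finset.measurable_prod _ fun j _ => measurable_smearedLatticeField_torusLift' r.curvature _ _ _ _ (F.f i j) _
  have hfacb : ∀ (h : 𝓢(E4, ℝ)), ∃ C : ℝ, ∀ V : LGConfig 4 G, |smearedLatticeField r.curvature.F (box 4 (sch.L k)) (sch.a k)
      (sch.c r.curvature k) (sch.m r.curvature k) h V| ≤ C := fun h =>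
    exists_abs_smearedLatticeField_le r.curvature _ _ _ _ h
  have hAb : ∀ i, ∃ C : ℝ, ∀ U, |A i U| ≤ C := by
    intro i
    choose C hC using fun j => hfacb (F.σf i j)
    refine ⟨∏ j, C j, fun U => ?_⟩
    rw [hA]; dsimp only
    rw [Finset.abs_prod]
    exact Finset.prod_le_prod (fun j _ => abs_nonneg _) fun j _ => hC j _
  have hBb : ∀ i, ∃ C : ℝ, ∀ U, |B i U| ≤ C := by
    intro i
    choose C hC using fun j => hfacb (F.f i j)
    refine ⟨∏ j, C j, fun U => ?_⟩
    rw [hB]; dsimp only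
    rw [Finset.abs_prod]
    exact Finset.prod_le_prod (fun j _ => abs_nonneg _) fun j _ => hC j _
  have hint : ∀ i i', Integrable (fun U => A i U * B i' U) μ := by
    intro i i'
    obtain ⟨C, hC⟩ := hAb i
    obtain ⟨C', hC'⟩ := hBb i'
    refine Integrable.of_bound (C := C * C') ((hAm i).mul (hBm i')).aestronglyMeasurable (Eventually.of_forall fun U => ?_)
    rw [Real.norm_eq_abs, abs_mul]
    exact mul_le_mul (hC U) (hC' U) (abs_nonneg _) ((abs_nonneg _).trans (hC U))
  have hsplit : ∀ i i', cubeLatticeSchwinger r.ρ sch R (fun s => s.F) k (F.n i + F.n i') (fun _ => r.curvature)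
      (Fin.append (F.σf i) (F.f i')) = ∫ U, A i U * B i' U ∂μ := by
    intro i i'
    unfold cubeLatticeSchwinger
    refine integral_congr_ae (Eventually.of_forall fun U => ?_)
    dsimp only
    rw [Fin.prod_univ_add]
    simp only [Fin.append_left, Fin.append_right, hA, hB]
  calc cubeGramPairing r sch R F k
      = ∑ i, ∑ i', F.c i * F.c i' * ∫ U, A i U * B i' U ∂μ := by
        unfold cubeGramPairing
        exact Finset.sum_congr rfl fun i _ => Finset.sum_congr rfl fun i' _ => by rw [hsplit]
    _ = ∑ i, ∑ i', ∫ U, F.c i * F.c i' * (A i U * B i' U) ∂μ := by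
        refine Finset.sum_congr rfl fun i _ => Finset.sum_congr rfl fun i' _ => ?_
        rw [integral_const_mul]
    _ = ∫ U, ∑ i, ∑ i', F.c i * F.c i' * (A i U * B i' U) ∂μ := by
        rw [integral_finsetSum _ fun i _ => integrable_finsetSum _ fun i' _ => (hint i i').const_mul _]
        exact Finset.sum_congr rfl fun i _ => (integral_finsetSum _ fun i' _ => (hint i i').const_mul _).symm
    _ = ∫ U, (∑ i, F.c i * A i U) * (∑ i', F.c i' * B i' U) ∂μ := by
        refine integral_congr_ae (Eventually.of_forall fun U => ?_)
        dsimp only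
        rw [Finset.sum_mul_sum]
        exact Finset.sum_congr rfl fun i _ => Finset.sum_congr rfl fun i' _ => by ring
    _ = ∫ U, famObs r sch F k (torusLift (sch.side k) (configPerm (Equiv.swap (0 : Fin 4) 1) U)) *
          famObs r sch F k (torusLift (sch.side k) U) ∂μ := by
        refine integral_congr_ae (Eventually.of_forall fun U => ?_)
        dsimp only
        rw [← mirrorObs_eq_famObs_swap r sch F k U]
        rfl

end Measure

/-! ## §2 Support: eventually the family observable lives in the closed positive half-cube -/

section Support

/-- Inside the box the centred representative of a lifted lattice point is the point: `rep (2L+1) (proj y) μ = y μ` when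
`|y μ| ≤ L`. -/
theorem rep_proj_of_abs_le {L : ℕ} {y : Literature.Probability.LatticeModels.Site 4} {μ : Fin 4} (hy : |y μ| ≤ (L : ℤ)) :
    rep (2 * L + 1) (Literature.Probability.LatticeModels.Torus.proj (2 * L + 1) y) μ = y μ := by
  haveI : NeZero (2 * L + 1) := ⟨Nat.succ_ne_zero _⟩
  simp only [rep, Literature.Probability.LatticeModels.Torus.proj_apply]
  refine (ZMod.valMinAbs_spec _ _).2 ⟨rfl, ?_, ?_⟩
  · rw [abs_le] at hy; push_cast; omega
  · rw [abs_le] at hy; push_cast; omega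

/-- A compact family of supports has a coordinate bound. -/
theorem exists_coord_bound (F : ReflectedFamily) :
    ∃ D : ℝ, ∀ i j (y : E4), y ∈ tsupport (F.f i j : E4 → ℝ) → ∀ μ, |y μ| ≤ D := by
  have hb : ∀ i j, ∃ D : ℝ, ∀ y ∈ tsupport (F.f i j : E4 → ℝ), ‖y‖ ≤ D := fun i j =>
    ((F.compact i j).isCompact.isBounded).exists_norm_le
  choose D hD using hb
  refine ⟨∑ i, ∑ j, |D i j|, fun i j y hy μ => ?_⟩
  calc |y μ| = ‖y μ‖ := (Real.norm_eq_abs _).symm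
    _ ≤ ‖y‖ := PiLp.norm_apply_le y μ
    _ ≤ D i j := hD i j y hy
    _ ≤ |D i j| := le_abs_self _
    _ ≤ ∑ j', |D i j'| := Finset.single_le_sum (f := fun j' => |D i j'|) (fun _ _ => abs_nonneg _) (Finset.mem_univ j)
    _ ≤ ∑ i', ∑ j', |D i' j'| :=
        Finset.single_le_sum (f := fun i' => ∑ j', |D i' j'|) (fun _ _ => Finset.sum_nonneg fun _ _ => abs_nonneg _)
          (Finset.mem_univ i)

/-- A lattice point charged by a test function with coordinate bound `D` at spacing `a > 0` has `|x μ| ≤ D / a`. -/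
theorem coord_bound_of_charged {f : 𝓢(E4, ℝ)} {D a : ℝ} (ha : 0 < a) (hf : ∀ y : E4, y ∈ tsupport (f : E4 → ℝ) → ∀ μ, |y μ| ≤ D)
    (x : Literature.Probability.LatticeModels.Site 4) (hx : f (a • siteToE x) ≠ 0) (μ : Fin 4) : |((x μ : ℤ) : ℝ)| ≤ D / a := by
  have hmem : a • siteToE x ∈ tsupport (f : E4 → ℝ) := subset_tsupport _ (Function.mem_support.2 hx)
  have h := hf _ hmem μ
  have hcoord : (a • siteToE x) μ = a * ((x μ : ℤ) : ℝ) := by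
    simp only [PiLp.smul_apply, siteToE_apply, smul_eq_mul]
  rw [hcoord, abs_mul, abs_of_pos ha] at h
  rw [le_div_iff₀ ha, mul_comm]
  exact h

variable {G : Type} [Group G] [TopologicalSpace G] [IsTopologicalGroup G] [CompactSpace G] [MeasurableSpace G] [BorelSpace G]
  (r : LatticeRep G) (sch : SpeciesScheme (YMSpecies G)) (R : ℕ → ℕ)

/-- **Support of the family observable (door C, S1b bookkeeping).**  For radii `R_k ≤ L_k` with `a_k R_k → ∞`, EVENTUALLY in `k` the
family observable of a reflected family, read at the periodic lift, depends only on the links of the closed positive half of the free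
hypercube `Q_{R_k}` of the scheme's own torus. -/
theorem eventually_dependsOn_famObs (hRL : ∀ k, R k ≤ sch.L k) (hRa : Tendsto (fun k => sch.a k * (R k : ℝ)) atTop atTop)
    (F : ReflectedFamily) :
    ∀ᶠ k in atTop, DependsOn (fun U : GaugeConfig 4 (sch.side k) G => famObs r sch F k (torusLift (sch.side k) U))
      {e : Edge 4 (sch.side k) | PosHalfEdge (sch.side k) (R k) e} := by
  obtain ⟨δ, Rs, hδ, hslab⟩ := exists_slab_margins F
  obtain ⟨D, hD⟩ := exists_coord_bound F
  obtain ⟨ϱ, hϱ⟩ := exists_radius r.curvature.supp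
  -- eventually `δ / a_k ≥ 2ϱ + 1` and `D / a_k + ϱ + 1 ≤ R_k`
  have h1 : ∀ᶠ k in atTop, (2 * ϱ + 1 : ℝ) ≤ δ / sch.a k := by
    have ht : Tendsto (fun k => δ / sch.a k) atTop atTop :=
      Tendsto.const_mul_atTop hδ (tendsto_inv_nhdsGT_zero.comp
        (tendsto_nhdsWithin_iff.2 ⟨sch.tendsto_a, Eventually.of_forall fun k => sch.a_pos k⟩))
    exact ht.eventually_ge_atTop _
  have h2 : ∀ᶠ k in atTop, D + (ϱ + 1 : ℝ) ≤ sch.a k * R k := hRa.eventually_ge_atTop _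
  have h3 : ∀ᶠ k in atTop, sch.a k ≤ 1 := (tendsto_order.1 sch.tendsto_a).2 1 one_pos |>.mono fun k hk => hk.le
  filter_upwards [h1, h2, h3] with k hk1 hk2 hk3
  have ha := sch.a_pos k
  have hk2' : D / sch.a k + (ϱ + 1 : ℝ) ≤ R k := by
    rw [div_add' _ _ _ ha.ne', div_le_iff₀ ha]
    have hϱ0 : (0 : ℝ) ≤ ϱ + 1 := by positivity
    nlinarith
  intro U V hUV
  unfold famObs
  refine Finset.sum_congr rfl fun i _ => ?_
  congr 1
  refine Finset.prod_congr rfl fun j _ => ?_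
  unfold smearedLatticeField
  congr 1
  refine Finset.sum_congr rfl fun x _ => ?_
  by_cases h0 : F.f i j (sch.a k • siteToE x) = 0
  · rw [h0, zero_mul, zero_mul]
  congr 2
  refine r.curvature.isCylinder fun e he => ?_
  have he' := hϱ e (Finset.mem_coe.1 he)
  -- the charged point `x`: slab index and coordinates
  have hsl := slabIndex_bounds_of_charged ha (hslab i j) x h0
  have hco := fun μ => coord_bound_of_charged ha (hD i j) x h0 μ
  have hv : (2 * ϱ + 1 : ℤ) ≤ x 0 - x 1 := by
    have h01 := hsl.1
    push_cast at h01
    have : ((2 * ϱ + 1 : ℤ) : ℝ) ≤ ((x 0 - x 1 : ℤ) : ℝ) := by push_cast; exact hk1.trans h01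
    exact_mod_cast this
  have hxR : ∀ μ, |x μ| + (ϱ : ℤ) + 1 ≤ R k := by
    intro μ
    have hμ := hco μ
    have : ((|x μ| + ϱ + 1 : ℤ) : ℝ) ≤ ((R k : ℤ) : ℝ) := by
      push_cast
      linarith
    exact_mod_cast this
  have hRL' := hRL k
  simp only [configShift_apply]
  change U (Literature.Probability.LatticeModels.Torus.proj (sch.side k) (e.1 - -x), e.2) =
    V (Literature.Probability.LatticeModels.Torus.proj (sch.side k) (e.1 - -x), e.2)
  apply hUV
  -- the torus edge lies in the closed positive half-cube
  have hy : ∀ μ, (e.1 - -x) μ = e.1 μ + x μ := fun μ => by simp only [Pi.sub_apply, Pi.neg_apply, sub_neg_eq_add]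
  have hrep : ∀ μ, rep (sch.side k) (Literature.Probability.LatticeModels.Torus.proj (sch.side k) (e.1 - -x)) μ = e.1 μ + x μ := by
    intro μ
    rw [← hy]
    refine rep_proj_of_abs_le ?_
    have h1 := he' μ; have h2 := hxR μ
    rw [hy, abs_le]; rw [abs_le] at h1; have h3 := abs_le.1 (show |x μ| ≤ |x μ| from le_rfl); constructor <;> omega
  have he0 := he' 0; have he1 := he' 1; have hee := he' e.2
  rw [abs_le] at he0 he1 hee
  simp only [Set.mem_setOf_eq, PosHalfEdge, hrep, dv]
  refine ⟨fun μ => ?_, ?_, ?_, ?_⟩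
  · have h1 := he' μ; have h2 := hxR μ
    rw [abs_le] at h1 ⊢; have h3 := le_abs_self (x μ); have h4 := neg_abs_le (x μ); constructor <;> omega
  · have h2 := hxR e.2; have h3 := le_abs_self (x e.2); omega
  · omega
  · split_ifs <;> omega

end Support

/-! ## §3 S1b: the free-cube Gram pairing of a reflected family is eventually non-negative -/

section S1b

variable {G : Type} [Group G] [TopologicalSpace G] [IsTopologicalGroup G] [CompactSpace G] [MeasurableSpace G] [BorelSpace G]
  (r : LatticeRep G) (sch : SpeciesScheme (YMSpecies G)) (R : ℕ → ℕ)

/-- **S1b.**  If the free hypercube is swap-RP (`CubeHalfRP G`, S1a), the couplings are eventually non-negative and the radii fit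
(`R_k ≤ L_k`) and grow in physical units (`a_k R_k → ∞`), then the free-cube Gram pairing of every reflected family is eventually `≥ 0`:
it is `∫ Y(ΘU) Y(U) dμ_{Q_R}` with `Y` bounded, measurable and (eventually) supported in the closed positive half-cube. -/
theorem eventually_cubeGramPairing_nonneg (hC : CubeHalfRP G) (hβ : ∀ᶠ k in atTop, 0 ≤ sch.β k) (hRL : ∀ k, R k ≤ sch.L k)
    (hRa : Tendsto (fun k => sch.a k * (R k : ℝ)) atTop atTop) (F : ReflectedFamily) :
    ∀ᶠ k in atTop, 0 ≤ cubeGramPairing r sch R F k := by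
  filter_upwards [hβ, eventually_dependsOn_famObs r sch R hRL hRa F] with k hβk hdep
  obtain ⟨B, hB⟩ := exists_abs_famObs_le r sch F k
  rw [cubeGramPairing_eq_integral_famObs_swap]
  have hRS : 2 * R k + 1 ≤ sch.side k := by have := hRL k; unfold SpeciesScheme.side; omega
  exact hC r.N r.ρ r.continuous r.mem_unitary (sch.β k) hβk (sch.side k) (R k) hRS
    (fun U => famObs r sch F k (torusLift (sch.side k) U)) B (measurable_famObs_torusLift r sch F k) (fun U => hB _) hdep

end S1b

/-! ## §4 Door C's composition: cube swap-RP + decoupling ⇒ the socket `OddTorusSwapPairingLiminf` -/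

section Composition

variable {G : Type} [Group G] [TopologicalSpace G] [IsTopologicalGroup G] [CompactSpace G] [MeasurableSpace G] [BorelSpace G]
  (r : LatticeRep G) (sch : SpeciesScheme (YMSpecies G))

/-- **Door C (card #114): exact cube swap-RP + decoupling ⇒ the lattice socket.**  `CubeHalfRP G` (S1a), eventual `β_k ≥ 0`, fitting
and growing radii, and THE LETTER `CubeDecoupling r sch R` give `OddTorusSwapPairingLiminf r sch` (p827497, BY NAME): the torus Gram
pairing is the free-cube one (eventually `≥ 0`, S1b) up to `o(1)`. -/
theorem pairingLiminf_of_cubeHalfRP (hC : CubeHalfRP G) (hβ : ∀ᶠ k in atTop, 0 ≤ sch.β k) (R : ℕ → ℕ)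
    (hRL : ∀ k, R k ≤ sch.L k) (hRa : Tendsto (fun k => sch.a k * (R k : ℝ)) atTop atTop) (hdec : CubeDecoupling r sch R) :
    OddTorusSwapPairingLiminf r sch := by
  intro m n c f σf hf hdisj hσ
  -- bundle the family
  let F : ReflectedFamily := ⟨m, n, c, f, σf, fun i j => (hf i j).1, fun i j => (hf i j).2, hσ⟩
  have hε : Tendsto (fun k => |gramPairing r sch F k - cubeGramPairing r sch R F k|) atTop (𝓝 0) := by
    simpa using (hdec F hdisj).abs
  refine liminf_nonneg_of_eventually_ge hε ?_
  filter_upwards [eventually_cubeGramPairing_nonneg r sch R hC hβ hRL hRa F] with k hk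
  show -|gramPairing r sch F k - cubeGramPairing r sch R F k| ≤ gramPairing r sch F k
  linarith [neg_abs_le (gramPairing r sch F k - cubeGramPairing r sch R F k)]

/-- **Scheme-level packaging**: at weak coupling (`β_k → ∞`, so `β_k ≥ 0` eventually), cube swap-RP and an admissible decoupling give the
socket. -/
theorem oddTorusSwapPairingLiminf_of_cubeHalfRP_of_admissible (hC : CubeHalfRP G) (hw : sch.HasWeakCouplingLimit)
    (hdec : AdmissibleCubeDecoupling r sch) : OddTorusSwapPairingLiminf r sch := by
  obtain ⟨R, hRL, hRa, hd⟩ := hdec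
  exact pairingLiminf_of_cubeHalfRP r sch hC ((tendsto_atTop.1 hw) 0) R hRL hRa hd

/-- **Along a subsequence `φ`** (the register of D1′): cube swap-RP, weak coupling of the SCHEME and an admissible decoupling of the
SUB-SCHEME give the socket of the sub-scheme `OddTorusSwapPairingLiminf r (subseq sch φ hφ)`. -/
theorem oddTorusSwapPairingLiminf_subseq_of_cubeHalfRP (hC : CubeHalfRP G) (hw : sch.HasWeakCouplingLimit) (φ : ℕ → ℕ)
    (hφ : StrictMono φ) (hdec : AdmissibleCubeDecoupling r (subseq sch φ hφ)) :
    OddTorusSwapPairingLiminf r (subseq sch φ hφ) :=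
  oddTorusSwapPairingLiminf_of_cubeHalfRP_of_admissible r (subseq sch φ hφ) hC (hasWeakCouplingLimit_subseq sch φ hφ hw) hdec

end Composition

end Summit.QuantumFields.YangMills.Cruxes.DiagonalMirrorRPR.CubeSurgery

end
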